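import Literature.Probability.LatticeModels.GridDomainScreening
import Literature.Probability.LatticeModels.GridDomainHarmonicApproximation
import Literature.Probability.LatticeModels.LatticeHarnackConformalLocal
import HarnessLib

/-!
# A Carleson-type bound for the exit-probability ratio of a grid domain (towards LSW 2004,
# Prop. 2.2): `h = H(·,u)/H(0,u)` is bounded at conformal distance `≥ ρ₀` from `ψ(u)`

Topic `Literature/Probability/LatticeModels`; continuation of `GridDomainScreening.lean`,
`GridDomainGreenTruncation.lean` and `LatticeHarnackConformalLocal.lean`, towards the proof of
G. F. Lawler, O. Schramm, W. Werner, *Conformal invariance of planar loop-erased random walks and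
uniform spanning trees*, Ann. Probab. 32 (2004), Proposition 2.2 (arXiv math/0112234, Prop. 5,
proof in §5.2).

In the printed proof the function `h(w) = H(w,u)/H(0,u) = G(w,q)/G(0,q)` (`u = (v, [q,v])` a
boundary dart, `G` the Green function of the walk on `V(D)`) is shown to be small near the part of
the boundary conformally away from `c = ψ(u)` by considering a path `J ⊂ V(D)` from a point `z` to
`u` along which `h ≥ h(z)/2` (discrete maximum principle) and the harmonic measure of `J` in
`D ∖ J` seen from `0` (boundary-hitting Lemma 5.4 applied in `D ∖ J`). This file proves the
resulting **a priori bound** in the form consumed by the compactness argument: for every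
`ρ₀ ∈ (0, 1/4]` there are `C` and `r₁` such that, granted the boundary-hitting lemma
(`boundaryHitting`, the tree's statement of LSW Lemma 5.4, taken here as a HYPOTHESIS), for every
`D ∈ 𝔇` with `inrad(D) ≥ r₁`, every disc map `ψ`, every dart with `H(0,u) ≠ 0` and every unit
vector `c` with `|ψ(q) - c| ≤ μ(inrad D)` (the boundary value of the dart satisfies this,
`norm_boundaryValue_sub_le`): `h(z) ≤ C` at every `z ∈ V(D)` with `|ψ(z) - c| ≥ ρ₀`
(`LSWGrid.exitProb_ratio_le_of_far`).

The proof follows the printed one with the harmonic-measure step replaced by an elementary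
screening argument that avoids prime ends: the level path `J` (`exists_levelPath`, from
`SRW.reachable_superlevel`) runs from the last vertex `z₁` at conformal distance `≥ ρ₀` from `c`
to `q`; either some vertex of `J` is at conformal height `≥ s` (then the local conformal Harnack
inequality `harnack_conformal_local` bounds `h` there, hence `h(z) ≤ (3/2) C_A`), or all of `ψ(J)` hugs
the circle across the angular window between `ψ(z₁)` and `c`; then a lattice site `x⁺` at
conformal height `≈ η/2` in the middle of the window is screened from `∂D` by `J`
(`screened_component`), so that the walk from `x⁺` hits `J` before `∂D` unless it travels
conformal distance `ρ₀/16`, which by `boundaryHitting` has probability `≤ 1/4`; the finite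
maximum principle `mul_one_sub_hitBeforeExitProb_le_killedGreen` gives `G(x⁺,q) ≥ G(z,q)/2`, and
Harnack at `x⁺` gives `h(z) ≤ 2 C_A`. Everything is proved; no named fact is introduced.

## References

* G. F. Lawler, O. Schramm, W. Werner, Ann. Probab. 32 (2004), Prop. 2.2 and §5.2 (arXiv
  pp. 10, 28–29), Lemma 5.2 (Harnack), Lemma 5.4 (boundary hitting). [LawlerSchrammWerner2004]
-/

noncomputable section

open Set Metric Filter
open scoped Topology ComplexConjugate

namespace Literature.Probability.LatticeModels

namespace LSWGrid

open Literature.Analysis.Complex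
open Literature.Probability.RandomPlanarGeometry (ChordalLERW.siteGraph ChordalLERW.siteGraph_adj_iff
  ChordalLERW.siteGraph_le_zdGraph)

variable {D : Set ℂ} {ψ : ℂ → ℂ}

/-! ### `h = G(·,q)/G(0,q)` is lattice-harmonic away from the boundary; Harnack bound -/

/-- `h = H(·,u)/H(0,u)` is lattice-harmonic at every site `x` with `B(x, 64) ⊆ D` (such a site is
in `V(D)` and is not the site `q` of the dart, which is at distance `1` from `v ∉ D`).
[cite: LawlerSchrammWerner2004, §5.2] -/
theorem isLatticeHarmonicOn_exitProb_ratio_local {q v : Site 2} (h0 : exitProb D 0 q v ≠ 0) :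
    IsLatticeHarmonicOn (fun w => exitProb D w q v / exitProb D 0 q v)
      {x : Site 2 | ball (Site.toComplex x) 64 ⊆ D} := by
  have hd := dart_of_exitProb_ne_zero h0
  intro x hx
  refine isLatticeHarmonicOn_exitProb_ratio h0 x ⟨hx (mem_ball_self (by norm_num)), ?_⟩
  rintro rfl
  refine hd.2.2 (hx ?_)
  rw [mem_ball, dist_eq_norm, norm_toComplex_sub_of_adj hd.1]
  norm_num

/-- **Harnack bound for `h` at conformal radius `≤ r`** (LSW Lemma 5.2, `k = 0`, local form):
if `inrad(D)(1-r)² ≥ 10⁴` and `N ≥ 11000/(1-r)⁵` then `h(x) ≤ (2/c_*)^N` for every `x ∈ V(D)`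
with `|ψ(x)| ≤ r`. [cite: LawlerSchrammWerner2004, Lemma 5.2] -/
theorem exitProb_ratio_le_of_norm_le (hD : IsClassD D) (hψ : IsDiscMap D ψ) {q v : Site 2}
    (h0 : exitProb D 0 q v ≠ 0) {r : ℝ} (hr : r < 1)
    (hbig : 10000 ≤ infDist (0 : ℂ) Dᶜ * (1 - r) ^ 2) {N : ℕ} (hN : 11000 / (1 - r) ^ 5 ≤ N)
    {x : Site 2} (hx : x ∈ latticeVertices D) (hxr : ‖ψ (Site.toComplex x)‖ ≤ r) :
    exitProb D x q v / exitProb D 0 q v ≤ (2 / maneuverConst) ^ N := by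
  obtain ⟨hsub, ⟨b, hb, hbρ⟩, -⟩ := toolkit_hyps hD hψ
  have hU : ∀ y : Site 2, ball (meshPoint 1 y) 64 ⊆ Function.invFunOn ψ D '' ball 0 1 →
      y ∈ {x : Site 2 | ball (Site.toComplex x) 64 ⊆ D} := fun y hy => by
    rwa [hψ.image_inv, meshPoint_one] at hy
  have hρ₀ := inrad_pos hD
  have hbρ' : ‖b - Function.invFunOn ψ D 0‖ ≤ 2 * infDist (0 : ℂ) Dᶜ := by linarith
  have key : (maneuverConst / 2) ^ N * (exitProb D x q v / exitProb D 0 q v) ≤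
      exitProb D 0 q v / exitProb D 0 q v := by
    have := (harnack_conformal_local (hψ.differentiableOn_inv hD.1.1) hψ.injOn_inv hρ₀ hsub hb
      hbρ' (fun w => exitProb_ratio_nonneg D w q v) (isLatticeHarmonicOn_exitProb_ratio_local h0)
      hU hr hbig hN hxr).2
    simpa only [hψ.inv_zero hD.2.2.1, nearestSite_one_zero, hψ.leftInvOn hx,
      nearestSite_one_toComplex] using this
  rw [div_self h0] at key
  have hc := maneuverConst_pos
  have hcN : 0 < (maneuverConst / 2) ^ N := by positivity
  rw [show (2 / maneuverConst) ^ N = ((maneuverConst / 2) ^ N)⁻¹ by rw [← inv_pow, inv_div],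
    ← one_div, le_div_iff₀ hcN, mul_comm]
  exact key

/-! ### The level path -/

/-- Walk surgery: on a lattice walk through `K` ending at a vertex where `f < ρ` and visiting a
vertex where `f ≥ ρ`, the LAST vertex `z₁` with `f(z₁) ≥ ρ` starts a terminal sub-walk
`z₁ ∼ y ⇝ q` all of whose later vertices have `f < ρ`. [folklore] -/
theorem exists_last_vertex_ge {K : Set (Site 2)} (f : Site 2 → ℝ) (ρ : ℝ) {z q : Site 2}
    (P : (zdGraph 2).Walk z q) (hP : ∀ x ∈ P.support, x ∈ K) (hq : f q < ρ)
    (hex : ∃ x ∈ P.support, ρ ≤ f x) :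
    ∃ z₁ y : Site 2, ∃ _ : (zdGraph 2).Adj z₁ y, ∃ W' : (zdGraph 2).Walk y q,
      z₁ ∈ K ∧ ρ ≤ f z₁ ∧ ∀ x ∈ W'.support, x ∈ K ∧ f x < ρ := by
  induction P with
  | nil =>
    obtain ⟨x, hx, hfx⟩ := hex
    rw [SimpleGraph.Walk.support_nil, List.mem_singleton] at hx
    subst hx
    exact absurd hq (not_lt.2 hfx)
  | @cons a b e hadj P ih =>
    by_cases hall : ∀ x ∈ P.support, f x < ρ
    · refine ⟨a, b, hadj, P, hP a (by simp), ?_, fun x hx => ⟨hP x (by simp [hx]), hall x hx⟩⟩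
      obtain ⟨x, hx, hfx⟩ := hex
      rw [SimpleGraph.Walk.support_cons, List.mem_cons] at hx
      rcases hx with rfl | hx
      · exact hfx
      · exact absurd (hall x hx) (not_lt.2 hfx)
    · push Not at hall
      exact ih (fun x hx => hP x (by simp [hx])) hq hall

/-- **The level path** ("a path from `z` to `u` in `V(D)` such that `h ≥ h(z)/2` on it, by the
maximum principle"): for `z ∈ V(D)` with `h(z) > 0` at conformal distance `≥ ρ` from a point
`c` with `|ψ(q) - c| < ρ`, there are a vertex `z₁` with `|ψ(z₁) - c| ≥ ρ` and a lattice walk `W`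
from `z₁` to `q` through vertices of `V(D)` where `G(·,q) ≥ (2/3) G(z,q)` and
`|ψ(·) - c| ≤ ρ + μ(inrad D)`. [cite: LawlerSchrammWerner2004, §5.2] -/
theorem exists_levelPath (hD : IsClassD D) (hψ : IsDiscMap D ψ) (hR : 8 ≤ infDist (0 : ℂ) Dᶜ)
    {q v : Site 2} (h0 : exitProb D 0 q v ≠ 0) {c : ℂ} {ρ : ℝ}
    (hqc : ‖ψ (Site.toComplex q) - c‖ < ρ) {z : Site 2} (hz : z ∈ latticeVertices D)
    (hzc : ρ ≤ ‖ψ (Site.toComplex z) - c‖) (hpos : 0 < exitProb D z q v) :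
    ∃ z₁ : Site 2, ∃ W : (zdGraph 2).Walk z₁ q,
      ρ ≤ ‖ψ (Site.toComplex z₁) - c‖ ∧
      ∀ x ∈ W.support, x ∈ latticeVertices D ∧
        2 / 3 * SRW.killedGreen (ChordalLERW.siteGraph (latticeVertices D)) z q ≤
          SRW.killedGreen (ChordalLERW.siteGraph (latticeVertices D)) x q ∧
        ‖ψ (Site.toComplex x) - c‖ ≤ ρ + 1500 / Real.sqrt (Real.log (infDist (0 : ℂ) Dᶜ / 3)) := by
  have hd := dart_of_exitProb_ne_zero h0
  have hsum := summable_of_exitProb_ne_zero h0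
  have hGz : 0 < SRW.killedGreen (ChordalLERW.siteGraph (latticeVertices D)) z q := by
    have := hpos
    rw [exitProb_eq hd] at this
    linarith
  have hreach := SRW.reachable_superlevel hsum hGz (θ := 2 / 3) (by norm_num) (by norm_num)
  have hzK : z ∈ {u | u ∈ latticeVertices D ∧
      2 / 3 * SRW.killedGreen (ChordalLERW.siteGraph (latticeVertices D)) z q ≤
        SRW.killedGreen (ChordalLERW.siteGraph (latticeVertices D)) u q} :=
    ⟨hz, by nlinarith [hGz.le]⟩
  obtain ⟨P, hP⟩ := exists_walk_of_reachable hreach hzK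
  obtain ⟨z₁, y, hadj, W', hz₁K, hz₁, hW'⟩ :=
    exists_last_vertex_ge (fun x => ‖ψ (Site.toComplex x) - c‖) ρ P hP hqc
      ⟨z, P.start_mem_support, hzc⟩
  refine ⟨z₁, SimpleGraph.Walk.cons hadj W', hz₁, ?_⟩
  have hyK := (hW' y W'.start_mem_support).1
  have hmesh := norm_sub_le_meshBound_of_adj hD hψ hR hz₁K.1 hyK.1 hadj
  have hμ0 : 0 ≤ 1500 / Real.sqrt (Real.log (infDist (0 : ℂ) Dᶜ / 3)) := by positivity
  intro x hx
  rw [SimpleGraph.Walk.support_cons, List.mem_cons] at hx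
  rcases hx with rfl | hx
  · refine ⟨hz₁K.1, hz₁K.2, ?_⟩
    have hy : ‖ψ (Site.toComplex y) - c‖ < ρ := (hW' y W'.start_mem_support).2
    have := norm_sub_le_norm_sub_add_norm_sub (ψ (Site.toComplex x)) (ψ (Site.toComplex y)) c
    linarith
  · obtain ⟨hxK, hfx⟩ := hW' x hx
    exact ⟨hxK.1, hxK.2, by linarith [hfx.le]⟩

/-! ### An elementary inequality: points of the disc near the circle and away from `1` -/

/-- A point `w` of the unit disc with `1 - s < |w| < 1`, `ρ ≤ |w - 1| ≤ 1/2`, where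
`s ≤ ρ/128`, `ρ ≤ 1/4`, has `|Im w| ≥ ρ/2`. [folklore] -/
theorem half_le_abs_im_of_near_circle {w : ℂ} {ρ s : ℝ} (hρ : 0 < ρ) (hρ4 : ρ ≤ 1 / 4)
    (hs : s ≤ ρ / 128) (hw1 : ρ ≤ ‖w - 1‖) (hw2 : ‖w - 1‖ ≤ 1 / 2) (hws : 1 - s < ‖w‖)
    (hw : ‖w‖ < 1) : ρ / 2 ≤ |w.im| := by
  by_contra hlt
  push Not at hlt
  have hn1 : ‖w - 1‖ ^ 2 = (w.re - 1) ^ 2 + w.im ^ 2 := by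
    rw [Complex.sq_norm, Complex.normSq_apply]
    simp only [Complex.sub_re, Complex.one_re, Complex.sub_im, Complex.one_im, sub_zero]
    ring
  have hn0 : ‖w‖ ^ 2 = w.re ^ 2 + w.im ^ 2 := by
    rw [Complex.sq_norm, Complex.normSq_apply]; ring
  have hre_abs : |w.re - 1| ≤ ‖w - 1‖ := by
    have := Complex.abs_re_le_norm (w - 1)
    simpa using this
  have hre : 1 / 2 ≤ w.re := by
    have := (abs_le.1 (hre_abs.trans hw2)).1
    linarith
  have hre_le : w.re ≤ ‖w‖ := Complex.re_le_norm w
  have h1 : ρ ^ 2 ≤ (w.re - 1) ^ 2 + w.im ^ 2 := by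
    rw [← hn1]; exact pow_le_pow_left₀ hρ.le hw1 2
  have him2 : w.im ^ 2 < (ρ / 2) ^ 2 :=
    sq_lt_sq' (by linarith [(abs_lt.1 hlt).1]) (abs_lt.1 hlt).2
  have htre : ‖w‖ - w.re ≤ w.im ^ 2 := by
    have hsum : 1 ≤ ‖w‖ + w.re := by linarith
    have hprod : (‖w‖ - w.re) * (‖w‖ + w.re) = w.im ^ 2 := by
      have : (‖w‖ - w.re) * (‖w‖ + w.re) = ‖w‖ ^ 2 - w.re ^ 2 := by ring
      rw [this, hn0]; ring
    nlinarith [mul_le_mul_of_nonneg_left hsum (sub_nonneg.2 hre_le)]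
  have h1re : 1 - w.re < ρ / 128 + (ρ / 2) ^ 2 := by linarith
  have h1re' : 1 - w.re < 9 * ρ / 128 := by nlinarith
  have h1re0 : 0 ≤ 1 - w.re := by linarith
  have hA : (1 - w.re) ^ 2 < (9 * ρ / 128) ^ 2 := by
    have := mul_self_lt_mul_self h1re0 h1re'
    nlinarith [this]
  have hB : (w.re - 1) ^ 2 = (1 - w.re) ^ 2 := by ring
  nlinarith [h1, him2, hA, hB, hρ]

/-! ### Conjugate-coordinate bookkeeping -/

/-- Multiplication by `c̄`, `|c| = 1`, is an isometry. [folklore] -/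
theorem norm_mul_conj_sub {c : ℂ} (hc : ‖c‖ = 1) (ξ ζ : ℂ) :
    ‖ξ * conj c - ζ * conj c‖ = ‖ξ - ζ‖ := by
  rw [← sub_mul, norm_mul, Complex.norm_conj, hc, mul_one]

/-- `|ξ c̄ - 1| = |ξ - c|` for `|c| = 1`. [folklore] -/
theorem norm_mul_conj_sub_one {c : ℂ} (hc : ‖c‖ = 1) (ξ : ℂ) :
    ‖ξ * conj c - 1‖ = ‖ξ - c‖ := by
  have hcc : c * conj c = 1 := by
    rw [Complex.mul_conj, Complex.normSq_eq_norm_sq, hc]; norm_num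
  rw [← hcc, norm_mul_conj_sub hc]

/-- `|ξ c̄| = |ξ|` for `|c| = 1`. [folklore] -/
theorem norm_mul_conj {c : ℂ} (hc : ‖c‖ = 1) (ξ : ℂ) : ‖ξ * conj c‖ = ‖ξ‖ := by
  rw [norm_mul, Complex.norm_conj, hc, mul_one]

/-- Imaginary parts in the `c̄`-coordinate are `1`-Lipschitz. [folklore] -/
theorem abs_im_sub_im_le {c : ℂ} (hc : ‖c‖ = 1) (ξ ζ : ℂ) :
    |(ξ * conj c).im - (ζ * conj c).im| ≤ ‖ξ - ζ‖ := by
  rw [← Complex.sub_im, ← norm_mul_conj_sub hc]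
  exact Complex.abs_im_le_norm _

/-- Real parts in the `c̄`-coordinate are `1`-Lipschitz. [folklore] -/
theorem abs_re_sub_re_le {c : ℂ} (hc : ‖c‖ = 1) (ξ ζ : ℂ) :
    |(ξ * conj c).re - (ζ * conj c).re| ≤ ‖ξ - ζ‖ := by
  rw [← Complex.sub_re, ← norm_mul_conj_sub hc]
  exact Complex.abs_re_le_norm _

/-! ### The Carleson-type bound -/

set_option maxHeartbeats 800000 in
/-- **A priori bound for `h = H(·,u)/H(0,u)` away from `ψ(u)`** (the bound behind "`h(v) < ε'`
near the boundary away from `u`" in the proof of Prop. 2.2, §5.2, here at conformal distance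
`≥ ρ₀` from `c` and without the smallness): for `0 < ρ₀ ≤ 1/4` there are `C > 0` and `r₁ > 0`
such that, GRANTED THE BOUNDARY-HITTING LEMMA `boundaryHitting` (LSW Lemma 5.4, a hypothesis
here), for every `D ∈ 𝔇` with `inrad(D) ≥ r₁`, every disc map `ψ`, every dart `(q, v)` with
`H(0,u) ≠ 0`, every unit vector `c` with `|ψ(q) - c| ≤ 1500/√(log(inrad D/3))` and every
`z ∈ V(D)` with `|ψ(z) - c| ≥ ρ₀`: `H(z,u)/H(0,u) ≤ C`. [cite: LawlerSchrammWerner2004, §5.2] -/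
theorem exitProb_ratio_le_of_far (hBH : boundaryHitting) {ρ₀ : ℝ} (hρ₀ : 0 < ρ₀)
    (hρ₀4 : ρ₀ ≤ 1 / 4) :
    ∃ C : ℝ, 0 < C ∧ ∃ r₁ : ℝ, 0 < r₁ ∧ ∀ D : Set ℂ, IsClassD D → r₁ ≤ infDist (0 : ℂ) Dᶜ →
      ∀ ψ : ℂ → ℂ, IsDiscMap D ψ → ∀ q v : Site 2, exitProb D 0 q v ≠ 0 →
      ∀ c : ℂ, ‖c‖ = 1 →
        ‖ψ (Site.toComplex q) - c‖ ≤ 1500 / Real.sqrt (Real.log (infDist (0 : ℂ) Dᶜ / 3)) →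
      ∀ z : Site 2, z ∈ latticeVertices D → ρ₀ ≤ ‖ψ (Site.toComplex z) - c‖ →
        exitProb D z q v / exitProb D 0 q v ≤ C := by
  -- the constants
  obtain ⟨δ, hδ, hBHδ⟩ := hBH (ρ₀ / 16) (1 / 4) (by positivity) (by norm_num)
  obtain ⟨η, hη0, hηδ, hηρ⟩ : ∃ η : ℝ, 0 < η ∧ η ≤ δ ∧ η ≤ ρ₀ / 16 :=
    ⟨min δ (ρ₀ / 16), lt_min hδ (by positivity), min_le_left _ _, min_le_right _ _⟩
  set s : ℝ := η / 8 with hs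
  have hs0 : 0 < s := by positivity
  have hsρ : s ≤ ρ₀ / 128 := by rw [hs]; linarith
  set N : ℕ := ⌈11000 / s ^ 5⌉₊ with hN
  have hNge : 11000 / (1 - (1 - s)) ^ 5 ≤ (N : ℝ) := by
    rw [sub_sub_cancel]; exact Nat.le_ceil _
  have hmc := maneuverConst_pos
  set CA : ℝ := (2 / maneuverConst) ^ N with hCA
  have hCA0 : 0 < CA := by positivity
  have hμ₀0 : 0 < η / 64 := by positivity
  set r₁ : ℝ := max (max 8 (3 * Real.exp ((1500 / (η / 64)) ^ 2)))
    (max (10000 / s ^ 2) (513 / η ^ 2)) with hr₁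
  refine ⟨2 * CA, by positivity, r₁,
    lt_of_lt_of_le (by norm_num) ((le_max_left _ _).trans (le_max_left _ _)), ?_⟩
  intro D hD hRr₁ ψ hψ q v h0 c hc hqc z hz hzc
  have hcc : c * conj c = 1 := by
    rw [Complex.mul_conj, Complex.normSq_eq_norm_sq, hc]; norm_num
  -- the size conditions
  have hR8 : 8 ≤ infDist (0 : ℂ) Dᶜ := ((le_max_left _ _).trans (le_max_left _ _)).trans hRr₁
  have hRexp : 3 * Real.exp ((1500 / (η / 64)) ^ 2) ≤ infDist (0 : ℂ) Dᶜ :=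
    ((le_max_right _ _).trans (le_max_left _ _)).trans hRr₁
  have hRs : 10000 / s ^ 2 ≤ infDist (0 : ℂ) Dᶜ :=
    ((le_max_left _ _).trans (le_max_right _ _)).trans hRr₁
  have hRη : 513 / η ^ 2 ≤ infDist (0 : ℂ) Dᶜ :=
    ((le_max_right _ _).trans (le_max_right _ _)).trans hRr₁
  have hR0 : 0 < infDist (0 : ℂ) Dᶜ := by linarith
  set μ : ℝ := 1500 / Real.sqrt (Real.log (infDist (0 : ℂ) Dᶜ / 3)) with hμdef
  have hμ : μ ≤ η / 64 := meshBound_le hμ₀0 hRexp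
  have hμ0 : 0 ≤ μ := by positivity
  have hbigH : 10000 ≤ infDist (0 : ℂ) Dᶜ * (1 - (1 - s)) ^ 2 := by
    rw [sub_sub_cancel]
    rw [div_le_iff₀ (by positivity)] at hRs
    linarith
  have hbigK : 32 < η / 8 * infDist (0 : ℂ) Dᶜ * (1 - (1 - η / 2)) := by
    rw [div_le_iff₀ (by positivity)] at hRη
    have : η / 8 * infDist (0 : ℂ) Dᶜ * (1 - (1 - η / 2)) = infDist (0 : ℂ) Dᶜ * η ^ 2 / 16 := by
      ring
    rw [this]; linarith
  -- the functions
  have hd := dart_of_exitProb_ne_zero h0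
  have hsum := summable_of_exitProb_ne_zero h0
  have hratio := exitProb_ratio_eq h0
  have hG0 : 0 < SRW.killedGreen (ChordalLERW.siteGraph (latticeVertices D)) 0 q :=
    lt_of_le_of_ne (SRW.killedGreen_nonneg _ _ _) (killedGreen_ne_zero_of_exitProb_ne_zero h0).symm
  have hHar : ∀ x ∈ latticeVertices D, ‖ψ (Site.toComplex x)‖ ≤ 1 - s →
      exitProb D x q v / exitProb D 0 q v ≤ CA := fun x hx hxs =>
    exitProb_ratio_le_of_norm_le hD hψ h0 (by linarith) hbigH hNge hx hxs
  -- the trivial case `h z = 0`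
  rcases (exitProb_ratio_nonneg D z q v).eq_or_lt with hzero | hpos
  · rw [← hzero]; positivity
  have hpos' : 0 < exitProb D z q v := by
    rcases (exitProb_nonneg D z q v).eq_or_lt with h | h
    · rw [← h, zero_div] at hpos; exact absurd hpos (lt_irrefl 0)
    · exact h
  -- the level path
  have hqc' : ‖ψ (Site.toComplex q) - c‖ < ρ₀ := by linarith
  obtain ⟨z₁, W, hz₁, hW⟩ := exists_levelPath hD hψ hR8 h0 hqc' hz hzc hpos'
  have hWV : ∀ x ∈ W.support, x ∈ latticeVertices D := fun x hx => (hW x hx).1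
  by_cases hI : ∃ x ∈ W.support, ‖ψ (Site.toComplex x)‖ ≤ 1 - s
  · -- Case I: a vertex of the level path at conformal height `≥ s`
    obtain ⟨x, hxW, hxs⟩ := hI
    obtain ⟨hxV, hGx, -⟩ := hW x hxW
    have h1 := hHar x hxV hxs
    rw [hratio] at h1 ⊢
    rw [div_le_iff₀ hG0] at h1 ⊢
    nlinarith [hG0, hCA0]
  -- Case II: the whole level path hugs the circle
  push Not at hI
  have hz₁W : z₁ ∈ W.support := W.start_mem_support
  have hqW : q ∈ W.support := W.end_mem_support
  have hz₁V : z₁ ∈ latticeVertices D := hWV z₁ hz₁W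
  have hz₁c : ‖ψ (Site.toComplex z₁) - c‖ ≤ ρ₀ + μ := (hW z₁ hz₁W).2.2
  have hz₁s : 1 - s < ‖ψ (Site.toComplex z₁)‖ := hI z₁ hz₁W
  -- the tangential coordinate of `ψ z₁` is at least `ρ₀/2` in absolute value
  have hT : ρ₀ / 2 ≤ |(ψ (Site.toComplex z₁) * conj c).im| := by
    refine half_le_abs_im_of_near_circle hρ₀ hρ₀4 hsρ ?_ ?_ ?_ ?_
    · rwa [norm_mul_conj_sub_one hc]
    · rw [norm_mul_conj_sub_one hc]; linarith
    · rwa [norm_mul_conj hc]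
    · rw [norm_mul_conj hc]; exact hψ.norm_lt_one hz₁V
  obtain ⟨σ, hσ1, hσT⟩ : ∃ σ : ℝ, (σ = 1 ∨ σ = -1) ∧
      ρ₀ / 2 ≤ σ * (ψ (Site.toComplex z₁) * conj c).im := by
    rcases le_or_gt 0 (ψ (Site.toComplex z₁) * conj c).im with h | h
    · exact ⟨1, Or.inl rfl, by rw [abs_of_nonneg h] at hT; linarith⟩
    · exact ⟨-1, Or.inr rfl, by rw [abs_of_neg h] at hT; linarith⟩
  have hσsq : σ ^ 2 = 1 := by rcases hσ1 with rfl | rfl <;> norm_num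
  -- the target point `ζ⁺` in the middle of the window, at conformal height `η/2`
  set xp : ℝ := Real.sqrt ((1 - η / 2) ^ 2 - (ρ₀ / 4) ^ 2) with hxp
  have hxp_arg : 0 ≤ (1 - η / 2) ^ 2 - (ρ₀ / 4) ^ 2 := by nlinarith
  have hxp2 : xp ^ 2 = (1 - η / 2) ^ 2 - (ρ₀ / 4) ^ 2 := Real.sq_sqrt hxp_arg
  have hxp0 : 0 ≤ xp := Real.sqrt_nonneg _
  have hxp_ge : 15 / 16 ≤ xp := by
    rw [hxp]
    refine Real.le_sqrt_of_sq_le ?_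
    have e1 : 1 - η ≤ (1 - η / 2) ^ 2 := by nlinarith [sq_nonneg (η / 2)]
    have e2 : (ρ₀ / 4) ^ 2 ≤ (1 / 16) ^ 2 :=
      pow_le_pow_left₀ (by positivity) (by linarith) 2
    norm_num at e2 ⊢
    linarith
  set ζp : ℂ := c * ((xp : ℂ) + ((σ * (ρ₀ / 4) : ℝ) : ℂ) * Complex.I) with hζp
  have hζp_mul : ζp * conj c = (xp : ℂ) + ((σ * (ρ₀ / 4) : ℝ) : ℂ) * Complex.I := by
    rw [hζp, mul_comm c, mul_assoc, hcc, mul_one]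
  have hζp_im : (ζp * conj c).im = σ * (ρ₀ / 4) := by
    rw [hζp_mul]
    simp only [Complex.add_im, Complex.ofReal_im, Complex.mul_im, Complex.ofReal_re,
      Complex.I_im, Complex.I_re, mul_one, mul_zero, add_zero, zero_add]
  have hζp_re : (ζp * conj c).re = xp := by
    rw [hζp_mul]
    simp only [Complex.add_re, Complex.ofReal_re, Complex.mul_re, Complex.ofReal_im,
      Complex.I_im, Complex.I_re, mul_one, mul_zero, sub_zero, add_zero]
  have hζp_norm : ‖ζp‖ = 1 - η / 2 := by
    rw [← norm_mul_conj hc, hζp_mul, Complex.norm_add_mul_I, mul_pow, hσsq, one_mul, hxp2,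
      sub_add_cancel, Real.sqrt_sq (by linarith)]
  -- the screened site `x⁺`
  obtain ⟨xplus, hxV, hxζ⟩ := exists_site_norm_sub_lt hD hψ (ζ₀ := ζp) (r := 1 - η / 2)
    hζp_norm.le (by linarith) (τ := η / 8) (by positivity) (by linarith) hbigK
  have hxn_le : ‖ψ (Site.toComplex xplus)‖ ≤ 1 - 3 * η / 8 := by
    have := norm_sub_norm_le (ψ (Site.toComplex xplus)) ζp
    linarith
  have hxn_ge : 1 - 5 * η / 8 < ‖ψ (Site.toComplex xplus)‖ := by
    have := norm_sub_norm_le ζp (ψ (Site.toComplex xplus))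
    rw [norm_sub_rev] at this
    linarith
  have hxs' : ‖ψ (Site.toComplex xplus)‖ ≤ 1 - s := by rw [hs]; linarith
  have hxδ : 1 - δ ≤ ‖ψ (Site.toComplex xplus)‖ := by linarith
  have hxW : xplus ∉ W.support := fun h => by have := hI _ h; rw [hs] at this; linarith
  -- the sets `S` (sites conformally near `x⁺`, off the path) and `Far`
  set S : Set (Site 2) := {y | y ∈ latticeVertices D ∧
    ‖ψ (Site.toComplex y) - ψ (Site.toComplex xplus)‖ ≤ ρ₀ / 16 ∧ y ∉ W.support} with hSdef
  have hSV : S ⊆ latticeVertices D := fun y hy => hy.1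
  have hSW : ∀ y ∈ S, y ∉ W.support := fun y hy => hy.2.2
  have hxS : xplus ∈ S := ⟨hxV, by rw [sub_self, norm_zero]; positivity, hxW⟩
  -- everything within `ρ₀/16 + η/8 + μ` of `ζ⁺` lies in the window
  have hwin : ∀ ξ : ℂ, ‖ξ - ζp‖ ≤ ρ₀ / 16 + η / 8 + μ →
      σ * (ρ₀ / 4) - ρ₀ / 8 ≤ (ξ * conj c).im ∧ (ξ * conj c).im ≤ σ * (ρ₀ / 4) + ρ₀ / 8 ∧
        1 - 3 * ρ₀ / 16 ≤ ‖ξ‖ ∧ 1 / 2 ≤ (ξ * conj c).re := by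
    intro ξ hξ
    have hd' : ‖ξ - ζp‖ ≤ 73 * ρ₀ / 1024 := by linarith
    have him := abs_im_sub_im_le hc ξ ζp
    have hre := abs_re_sub_re_le hc ξ ζp
    rw [hζp_im] at him
    rw [hζp_re] at hre
    have hn := norm_sub_norm_le ζp ξ
    rw [norm_sub_rev, hζp_norm] at hn
    refine ⟨by linarith [(abs_le.1 him).1], by linarith [(abs_le.1 him).2], by linarith,
      by linarith [(abs_le.1 hre).1]⟩
  have HS : ∀ ξ ∈ D, (∃ y ∈ S, ‖ψ ξ - ψ (Site.toComplex y)‖ ≤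
      1500 / Real.sqrt (Real.log (infDist (0 : ℂ) Dᶜ / 3))) →
      σ * (ρ₀ / 4) - ρ₀ / 8 ≤ (ψ ξ * conj c).im ∧ (ψ ξ * conj c).im ≤ σ * (ρ₀ / 4) + ρ₀ / 8 ∧
        1 - 3 * ρ₀ / 16 ≤ ‖ψ ξ‖ ∧ 1 / 2 ≤ (ψ ξ * conj c).re := by
    rintro ξ - ⟨y, hyS, hξy⟩
    refine hwin (ψ ξ) ?_
    have h1 := norm_sub_le_norm_sub_add_norm_sub (ψ ξ) (ψ (Site.toComplex y)) ζp
    have h2 := norm_sub_le_norm_sub_add_norm_sub (ψ (Site.toComplex y))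
      (ψ (Site.toComplex xplus)) ζp
    have h3 := hyS.2.1
    change ‖ψ ξ - ψ (Site.toComplex y)‖ ≤ μ at hξy
    linarith [hxζ.le]
  -- the window conditions on the polygon of the level path
  have hΓwin : ∀ zz ∈ range (walkPath W), 1 - 3 * ρ₀ / 16 ≤ ‖ψ zz‖ ∧
      1 / 2 ≤ (ψ zz * conj c).re ∧
      (σ * (ρ₀ / 4) - ρ₀ / 8 ≤ (ψ zz * conj c).im → (ψ zz * conj c).im ≤ σ * (ρ₀ / 4) + ρ₀ / 8 →
        1 - 3 * η / 8 < ‖ψ zz‖) := by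
    intro zz hzz
    obtain ⟨x, hxW', hzzx⟩ := exists_vertex_norm_sub_le hD hψ hR8 W hWV hzz
    change ‖ψ zz - ψ (Site.toComplex x)‖ ≤ μ at hzzx
    have hx1 := hI x hxW'
    have hx2 := (hW x hxW').2.2
    have hn := norm_sub_norm_le (ψ (Site.toComplex x)) (ψ zz)
    rw [norm_sub_rev] at hn
    have hre := abs_re_sub_re_le hc (ψ zz) c
    rw [hcc, Complex.one_re] at hre
    have hzzc := norm_sub_le_norm_sub_add_norm_sub (ψ zz) (ψ (Site.toComplex x)) c
    refine ⟨by linarith, by linarith [(abs_le.1 hre).1], fun _ _ => by rw [hs] at hx1; linarith⟩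
  -- the level path crosses the window: `q` on one side, `z₁` on the other
  have hqim : |(ψ (Site.toComplex q) * conj c).im| ≤ μ := by
    have := abs_im_sub_im_le hc (ψ (Site.toComplex q)) c
    rw [hcc, Complex.one_im, sub_zero] at this
    exact this.trans hqc
  have hΓa : ∃ x ∈ W.support, (ψ (Site.toComplex x) * conj c).im ≤ σ * (ρ₀ / 4) - ρ₀ / 8 := by
    rcases hσ1 with h1 | h1
    · exact ⟨q, hqW, by rw [h1]; linarith [(abs_le.1 hqim).2]⟩
    · exact ⟨z₁, hz₁W, by rw [h1] at hσT ⊢; linarith⟩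
  have hΓb : ∃ x ∈ W.support, σ * (ρ₀ / 4) + ρ₀ / 8 ≤ (ψ (Site.toComplex x) * conj c).im := by
    rcases hσ1 with h1 | h1
    · exact ⟨z₁, hz₁W, by rw [h1] at hσT ⊢; linarith⟩
    · exact ⟨q, hqW, by rw [h1]; linarith [(abs_le.1 hqim).1]⟩
  -- screening: the component `U` of `x⁺` in `siteGraph S`
  have hab : σ * (ρ₀ / 4) - ρ₀ / 8 ≤ σ * (ρ₀ / 4) + ρ₀ / 8 := by linarith
  have hlo : 1 - 3 * ρ₀ / 16 ≤ (1 : ℝ) := by linarith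
  obtain ⟨hUS, hUfin, hUfull, hUbd⟩ := screened_component hD hψ hR8 hc hab hlo
    (by norm_num : (0 : ℝ) < 1 / 2) W hWV hΓa hΓb hΓwin hSV hSW HS hxS hxn_le
  -- the finite maximum principle on `U`
  have hdisj : Disjoint {u | (ChordalLERW.siteGraph S).Reachable xplus u}
      {y | y ∈ latticeVertices D ∧
        ρ₀ / 16 < ‖ψ (Site.toComplex y) - ψ (Site.toComplex xplus)‖} := by
    rw [Set.disjoint_left]
    intro u huU huFar
    have := (hUS huU).2.1
    linarith [huFar.2]
  have hbd : ∀ u ∈ {u | (ChordalLERW.siteGraph S).Reachable xplus u}, ∀ e : SRW.Dir 2,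
      u + SRW.stepVec e ∉ {u | (ChordalLERW.siteGraph S).Reachable xplus u} →
      u + SRW.stepVec e ∈ {y | y ∈ W.support} ∨
        u + SRW.stepVec e ∈ {y | y ∈ latticeVertices D ∧
          ρ₀ / 16 < ‖ψ (Site.toComplex y) - ψ (Site.toComplex xplus)‖} := by
    intro u hu e hue
    have hnS := hUbd u hu e hue
    have hV := hUfull u hu e
    by_cases hJ : u + SRW.stepVec e ∈ W.support
    · exact Or.inl hJ
    · right
      refine ⟨hV, ?_⟩
      by_contra hle
      push Not at hle
      exact hnS ⟨hV, hle, hJ⟩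
  have hm0 : 0 ≤ 2 / 3 * SRW.killedGreen (ChordalLERW.siteGraph (latticeVertices D)) z q := by
    have := SRW.killedGreen_nonneg (ChordalLERW.siteGraph (latticeVertices D)) z q
    positivity
  have hlow := mul_one_sub_hitBeforeExitProb_le_killedGreen hsum hUfin (hUS.trans hSV) hdisj
    hUfull hbd hm0 (fun j hj => (hW j hj).2.1) (x := xplus) (SimpleGraph.Reachable.refl xplus)
  -- boundary hitting from `x⁺`
  have hhit := hBHδ D hD ψ hψ xplus hxV hxδ
  have hGz : SRW.killedGreen (ChordalLERW.siteGraph (latticeVertices D)) z q ≤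
      2 * SRW.killedGreen (ChordalLERW.siteGraph (latticeVertices D)) xplus q := by
    have hGz0 := SRW.killedGreen_nonneg (ChordalLERW.siteGraph (latticeVertices D)) z q
    nlinarith [mul_le_mul_of_nonneg_left (show (3 : ℝ) / 4 ≤ 1 - hitBeforeExitProb D xplus
      {y | y ∈ latticeVertices D ∧
        ρ₀ / 16 < ‖ψ (Site.toComplex y) - ψ (Site.toComplex xplus)‖} by linarith) hm0]
  -- Harnack at `x⁺`
  have hHx := hHar xplus hxV hxs'
  rw [hratio] at hHx ⊢
  rw [div_le_iff₀ hG0] at hHx ⊢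
  nlinarith [hG0, hCA0]

end LSWGrid

end Literature.Probability.LatticeModels

end
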